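import Mathlib
import Summits.ValiantsHypothesis.ValiantsHypothesis.Theses.FreeSubtorus
import Literature.Computability.AlgebraicComplexity.LRPencilOfMatrix

/-!
# `SubtorusCovering`, line `pair-sacrifice` — stub `stub_substLifts`

Helper for crux stmt-ValiantsHypothesis-16134
(`Summit.ValiantsHypothesis.ValiantsHypothesis.Theses.FreeSubtorus.SubtorusCovering`).

**Content.**  Let `B` be a `T_Λ`-equivariant affine determinantal representation of `per_{n'+s}`
(exact `GL_m × GL_m` lifts, `IsEquivariantDetRepr`) and let `aeval g` be the pair-sacrifice
substitution (`x_{(k,l)} ↦ x_{(k,l)}` on the free `n' × n'` block, `x_{(n'+j,n'+j)} ↦ 1`, `0`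
elsewhere on the last `s` rows and columns).  Assume every pair `(d', e')` of nowhere-vanishing
vectors of length `n'` extends to a pair `(d, e) ∈ (ℂˣ)^{n'+s} × (ℂˣ)^{n'+s}` satisfying the
`Λ`-relations with `d_{castAdd k} e_{castAdd l} = d'_k e'_l` and `d_{natAdd j} e_{natAdd j} = 1`.
Then every generator `diag(d'_k e'_l)` of the full two-sided torus of the free block lifts for the
substituted matrix `B.map (aeval g)`.

**Proof.**  Invertibility of the generator forces all `d'_k e'_l ≠ 0`, hence all `d'_k ≠ 0` and
`e'_l ≠ 0`; the extension `(d, e)` gives a generator `γ = diag(d_k e_l)` of `T_Λ`, which lifts for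
`B` by hypothesis; and `aeval g` intertwines the substitution by `γ` with the substitution by the
given generator (checked on variables, four block cases), so the same lift works for
`B.map (aeval g)`.
-/

set_option linter.dupNamespace false

namespace Summit.ValiantsHypothesis.ValiantsHypothesis.Theorems.FreeSubtorusSubtorusCovering

open Literature.Computability.AlgebraicComplexity MvPolynomial

/-- A diagonal matrix with unit diagonal entries is the matrix of an element of `GL`. [folklore] -/
private theorem exists_gl_coe_eq_diagonal {ι : Type*} [Fintype ι] [DecidableEq ι] (u : ι → ℂˣ) :
    ∃ γ : GL ι ℂ, (γ : Matrix ι ι ℂ) = Matrix.diagonal fun i => (u i : ℂ) := by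
  refine ⟨⟨Matrix.diagonal fun i => (u i : ℂ), Matrix.diagonal fun i => ((u i)⁻¹ : ℂˣ), ?_, ?_⟩,
    rfl⟩
  · rw [Matrix.diagonal_mul_diagonal, ← Matrix.diagonal_one]
    congr 1
    funext i
    simp
  · rw [Matrix.diagonal_mul_diagonal, ← Matrix.diagonal_one]
    congr 1
    funext i
    simp

/-- A diagonal linear substitution scales each variable: `linSubst (diagonal c) (X p) = c p • X p`.
[folklore] -/
private theorem linSubst_diagonal_X {σ : Type*} [Fintype σ] [DecidableEq σ] (c : σ → ℂ) (p : σ) :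
    linSubst σ ℂ (Matrix.diagonal c) (X p) = c p • X p := by
  rw [linSubst_X]
  rw [Finset.sum_eq_single p]
  · rw [Matrix.diagonal_apply_eq]
  · intro q _ hq
    rw [Matrix.diagonal_apply_ne _ hq, zero_smul]
  · intro h
    exact absurd (Finset.mem_univ p) h

/-- **Stub `stub_substLifts`** (line `pair-sacrifice` of `SubtorusCovering`) — every generator
`diag(d'_k e'_l)` of the full two-sided torus of the free `n' × n'` block lifts for the substituted
matrix `B.map (aeval g)`, given a `T_Λ`-equivariant `B` and the extension property of the free torus
across the sacrificed diagonal pairs. [folklore] -/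
theorem stub_substLifts :
    ∀ (n' s r m : ℕ) (Λ : Fin r → (Fin (n' + s) ⊕ Fin (n' + s)) → ℤ)
    (B : Matrix (Fin m) (Fin m) (MvPolynomial (Fin (n' + s) × Fin (n' + s)) ℂ))
    (g : Fin (n' + s) × Fin (n' + s) → MvPolynomial (Fin n' × Fin n') ℂ),
    (∀ k l, g (Fin.castAdd s k, Fin.castAdd s l) = X (k, l)) →
    (∀ k j, g (Fin.castAdd s k, Fin.natAdd n' j) = 0) →
    (∀ j l, g (Fin.natAdd n' j, Fin.castAdd s l) = 0) →
    (∀ j j', g (Fin.natAdd n' j, Fin.natAdd n' j') = if j = j' then 1 else 0) →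
    (∀ d' e' : Fin n' → ℂ, (∀ k, d' k ≠ 0) → (∀ l, e' l ≠ 0) →
      ∃ d e : Fin (n' + s) → ℂˣ,
        (∀ i, (∏ k, (d k) ^ (Λ i (Sum.inl k))) * (∏ l, (e l) ^ (Λ i (Sum.inr l))) = 1) ∧
        (∀ k l, (d (Fin.castAdd s k) : ℂ) * (e (Fin.castAdd s l) : ℂ) = d' k * e' l) ∧
        (∀ j, (d (Fin.natAdd n' j) : ℂ) * (e (Fin.natAdd n' j) : ℂ) = 1)) →
    IsEquivariantDetRepr (Subgroup.closure
        {γ : Matrix.GeneralLinearGroup (Fin (n' + s) × Fin (n' + s)) ℂ |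
          ∃ d e : Fin (n' + s) → ℂˣ,
            (∀ i, (∏ k, (d k) ^ (Λ i (Sum.inl k))) * (∏ l, (e l) ^ (Λ i (Sum.inr l))) = 1) ∧
            (γ : Matrix (Fin (n' + s) × Fin (n' + s)) (Fin (n' + s) × Fin (n' + s)) ℂ) =
              Matrix.diagonal (fun p => (d p.1 : ℂ) * (e p.2 : ℂ))})
      (perPoly (Fin (n' + s)) ℂ) B →
    ∀ γ' : Matrix.GeneralLinearGroup (Fin n' × Fin n') ℂ,
      γ' ∈ {γ' : Matrix.GeneralLinearGroup (Fin n' × Fin n') ℂ | ∃ d' e' : Fin n' → ℂ,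
          (γ' : Matrix (Fin n' × Fin n') (Fin n' × Fin n') ℂ) =
            Matrix.diagonal (fun p => d' p.1 * e' p.2)} →
      ∃ g₁ h₁ : GL (Fin m) ℂ,
        Matrix.linSubstEntries γ' (B.map (MvPolynomial.aeval g)) =
          (g₁ : Matrix (Fin m) (Fin m) ℂ).map C * B.map (MvPolynomial.aeval g) *
            ((h₁⁻¹ : GL (Fin m) ℂ) : Matrix (Fin m) (Fin m) ℂ).map C := by
  intro n' s r m Λ B g hg₁ hg₂ hg₃ hg₄ hext hB γ' hγ'
  obtain ⟨d', e', hγ'⟩ := hγ'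
  -- invertibility of `γ'` forces `d'_k e'_l ≠ 0`, hence `d'_k ≠ 0` and `e'_l ≠ 0`
  have hdet : (γ' : Matrix (Fin n' × Fin n') (Fin n' × Fin n') ℂ).det ≠ 0 := by
    rw [← Matrix.GeneralLinearGroup.val_det_apply]
    exact Units.ne_zero _
  rw [hγ', Matrix.det_diagonal] at hdet
  have hne : ∀ k l : Fin n', d' k * e' l ≠ 0 := fun k l =>
    Finset.prod_ne_zero_iff.1 hdet (k, l) (Finset.mem_univ _)
  -- extend `(d', e')` across the sacrificed pairs
  obtain ⟨d, e, hrel, hfree, hsac⟩ := hext d' e' (fun k => left_ne_zero_of_mul (hne k k))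
    (fun l => right_ne_zero_of_mul (hne l l))
  -- the torus element `γ = diag(d_k e_l) ∈ T_Λ` and its lift for `B`
  obtain ⟨γ, hγ⟩ : ∃ γ : GL (Fin (n' + s) × Fin (n' + s)) ℂ,
      (γ : Matrix (Fin (n' + s) × Fin (n' + s)) (Fin (n' + s) × Fin (n' + s)) ℂ) =
        Matrix.diagonal (fun p => (d p.1 : ℂ) * (e p.2 : ℂ)) :=
    exists_gl_coe_eq_diagonal (fun p : Fin (n' + s) × Fin (n' + s) => d p.1 * e p.2)
  have hγmem : γ ∈ Subgroup.closure
      {γ : Matrix.GeneralLinearGroup (Fin (n' + s) × Fin (n' + s)) ℂ |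
        ∃ d e : Fin (n' + s) → ℂˣ,
          (∀ i, (∏ k, (d k) ^ (Λ i (Sum.inl k))) * (∏ l, (e l) ^ (Λ i (Sum.inr l))) = 1) ∧
          (γ : Matrix (Fin (n' + s) × Fin (n' + s)) (Fin (n' + s) × Fin (n' + s)) ℂ) =
            Matrix.diagonal (fun p => (d p.1 : ℂ) * (e p.2 : ℂ))} :=
    Subgroup.subset_closure ⟨d, e, hrel, hγ⟩
  obtain ⟨g₁, h₁, hlift⟩ := hB.2 γ hγmem
  -- KEY: `aeval g` intertwines the substitution by `γ` with the substitution by `γ'`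
  have key : (aeval g).comp (linSubst (Fin (n' + s) × Fin (n' + s)) ℂ
        (γ : Matrix (Fin (n' + s) × Fin (n' + s)) (Fin (n' + s) × Fin (n' + s)) ℂ)) =
      (linSubst (Fin n' × Fin n') ℂ (γ' : Matrix (Fin n' × Fin n') (Fin n' × Fin n') ℂ)).comp
        (aeval g) := by
    apply MvPolynomial.algHom_ext
    rintro ⟨p₁, p₂⟩
    rw [AlgHom.comp_apply, AlgHom.comp_apply, hγ, hγ', linSubst_diagonal_X, map_smul, aeval_X]
    dsimp only
    induction p₁ using Fin.addCases with
    | left k =>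
      induction p₂ using Fin.addCases with
      | left l =>
        rw [hg₁, hfree, linSubst_diagonal_X]
      | right j =>
        rw [hg₂, smul_zero, map_zero]
    | right j =>
      induction p₂ using Fin.addCases with
      | left l =>
        rw [hg₃, smul_zero, map_zero]
      | right j' =>
        rw [hg₄]
        split_ifs with hjj
        · subst hjj
          rw [hsac, one_smul, map_one]
        · rw [smul_zero, map_zero]
  -- constants are fixed by `aeval g`
  have hC : ∀ M : Matrix (Fin m) (Fin m) ℂ,
      (M.map C : Matrix (Fin m) (Fin m) (MvPolynomial (Fin (n' + s) × Fin (n' + s)) ℂ)).map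
          (aeval g) =
        (M.map C : Matrix (Fin m) (Fin m) (MvPolynomial (Fin n' × Fin n') ℂ)) := by
    intro M
    rw [Matrix.map_map]
    congr 1
    funext c
    simp
  refine ⟨g₁, h₁, ?_⟩
  calc Matrix.linSubstEntries γ' (B.map (MvPolynomial.aeval g))
      = (Matrix.linSubstEntries γ B).map (MvPolynomial.aeval g) := by
        simp only [Matrix.linSubstEntries, Matrix.map_map]
        congr 1
        funext f
        exact (AlgHom.congr_fun key f).symm
    _ = (g₁ : Matrix (Fin m) (Fin m) ℂ).map C * B.map (MvPolynomial.aeval g) *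
          ((h₁⁻¹ : GL (Fin m) ℂ) : Matrix (Fin m) (Fin m) ℂ).map C := by
        rw [hlift, Matrix.map_mul, Matrix.map_mul, hC, hC]

end Summit.ValiantsHypothesis.ValiantsHypothesis.Theorems.FreeSubtorusSubtorusCovering
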